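import Summits.CriticalPhenomena.CardyFormulaZ2.Theses.CardyBoundaryCoulombGas
import Literature.Probability.Percolation.RSW
import Literature.Probability.Percolation.RSWProofs
import Literature.Probability.Percolation.RSWLemma
import Literature.Probability.Percolation.PlanarDuality
import Literature.Probability.Percolation.FiniteEnergy
import Literature.Probability.Percolation.BernoulliPercolation

/-!
# `StripClusterRates` (route `CardyBoundaryCoulombGas`, stmt-CriticalPhenomena-13878): the Kac values
# are NOT lower bounds at finite width — "Kac from above / at every width" is false

Negative lemmas for the crux `StripClusterRates` (cdisprove unit
refuter-cdisprove-stmt-CriticalPhenomena-13878-0; work file `Cruxes/StripClusterRates/Disproof.lean`).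
The crux asserts `n·γ₁(n) → π/3` and `n·γ₂(n) → 2π` for the lengthwise decay rates of "one
spanning cluster" and "two distinct spanning clusters" in the free strip of width `n`. Two NATURAL
STRENGTHENINGS — that the Kac values bound the finite-width rates from below (as a monotone
approach from above, or an exact finite-size Kac formula, would give) — are refuted by explicit
configurations:

* `pOne_ge`: `p₁(m,n) ≥ 2⁻ᵐ` (tree, bottom row), hence every limit of `-log p₁(m,n)/m` is `≤ log 2`
  (`rateOne_le`) and `not_kacLowerBoundEveryWidth_one`: `π/3 ≤ n·γ₁(n)` fails at `n = 1`.
* `pTwo_ge`: `p₂(m,n) ≥ 2^{-(3m+1)}` for `n ≥ 1` (rows 0 and 1 open, the `m+1` rungs closed: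
  `ladder_subset_twoClusterEvent`, the closed rungs seal row 0, `walk_stays_in_row_zero`), hence
  every limit of `-log p₂(m,n)/m` is `≤ 3 log 2` (`rateTwo_le`) and `n·γ₂(n) < 2π` for all `n ≤ 3`
  (`kacTwo_fails_upto_three`), so `not_kacLowerBoundEveryWidth_two`.
* The rigorous window is two-sided but blind to the constants: `rateOne_odd_width_le`
  (`γ₁(2j+1) ≤ 8 log 2/(j+1)` from the tree's Bollobás–Riordan constant and gluing) and
  `rateOne_antitone` give `limsup n·γ₁(n) ≤ 16 log 2`; numerically (exact transfer matrices, widths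
  ≤ 13, two independent bases) the approach to `π/3`, `2π` is monotone from BELOW.

Any proof of the crux must therefore produce `π/3`, `2π` as genuine `n → ∞` limits; no finite-width
Kac inequality is available to sandwich them from above.
-/

noncomputable section

open MeasureTheory Filter Topology
open Literature.Probability.LatticeModels Literature.Probability.Percolation

namespace Summit.CriticalPhenomena.CardyFormulaZ2.Theorems.StripClusterRates.Negative

open Summit.CriticalPhenomena.CardyFormulaZ2.Theses.CardyBoundaryCoulombGas (StripClusterRates StripRatesExist)

/-! ## §0 The objects of the crux -/

/-- `p₁(m,n) = P_{1/2}[LR crossing of [0,m]×[0,n]]`. [folklore] -/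
abbrev pOne (m n : ℕ) : ℝ := crossingProb half m n

/-- The event "two open LR crossings of `[0,m]×[0,n]` in distinct open clusters of the rectangle",
verbatim from the crux. [folklore] -/
def twoClusterEvent (m n : ℕ) : Set (BondConfig (Site 2)) :=
  {ω | ∃ x₁ ∈ (leftSide m n : Set (Site 2)), ∃ y₁ ∈ (rightSide m n : Set (Site 2)),
    ∃ x₂ ∈ (leftSide m n : Set (Site 2)), ∃ y₂ ∈ (rightSide m n : Set (Site 2)),
      ω ∈ openConnIn (rectangle m n : Set (Site 2)) x₁ y₁ ∧
      ω ∈ openConnIn (rectangle m n : Set (Site 2)) x₂ y₂ ∧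
      ω ∉ openConnIn (rectangle m n : Set (Site 2)) x₁ x₂}

/-- `p₂(m,n)`. [folklore] -/
abbrev pTwo (m n : ℕ) : ℝ := (bondPercolation (zdGraph 2) half).real (twoClusterEvent m n)

/-- The rate sequence `-log p₁(m,n)/m`. [folklore] -/
abbrev rateSeqOne (n : ℕ) : ℕ → ℝ := fun m ↦ -Real.log (pOne m n) / (m : ℝ)

/-- The rate sequence `-log p₂(m,n)/m`. [folklore] -/
abbrev rateSeqTwo (n : ℕ) : ℕ → ℝ := fun m ↦ -Real.log (pTwo m n) / (m : ℝ)

/-! ## §1 Explicit-configuration lower bounds on `p₁`, `p₂` -/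

/-- The `m` horizontal edges of row `1`: `{(i,1),(i+1,1)}`, `0 ≤ i < m`. [folklore] -/
def rowOneEdges (m : ℕ) : Finset (Sym2 (Site 2)) :=
  (Finset.range m).image fun i : ℕ => s(pt i 1, pt (i + 1) 1)

/-- The `m+1` rungs `{(i,0),(i,1)}`, `0 ≤ i ≤ m`, between rows `0` and `1`. [folklore] -/
def rungEdges (m : ℕ) : Finset (Sym2 (Site 2)) :=
  (Finset.range (m + 1)).image fun i : ℕ => s(pt i 0, pt i 1)

/-- Rows `0` and `1` together. [folklore] -/
def ladderRows (m : ℕ) : Finset (Sym2 (Site 2)) := bottomRowEdges m ∪ rowOneEdges m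

/-- The ladder configuration event: rows `0`,`1` open, all rungs between them closed. [folklore] -/
def ladderEvent (m : ℕ) : Set (BondConfig (Site 2)) :=
  {ω | (↑(ladderRows m) : Set (Sym2 (Site 2))) ⊆ ω} ∩ {ω | ∀ e ∈ rungEdges m, e ∉ ω}

/-- An open row `j ≤ n` joins `(0,j)` to `(k,j)` inside `[0,m]×[0,n]` for every `k ≤ m`. [folklore] -/
theorem openConnIn_row {m n j : ℕ} (hj : j ≤ n) {ω : BondConfig (Site 2)}
    (h : ∀ i : ℕ, i < m → s(pt i j, pt (i + 1) j) ∈ ω) :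
    ∀ k : ℕ, k ≤ m → ω ∈ openConnIn (rectangle m n : Set (Site 2)) (pt 0 j) (pt k j) := by
  have hmem : ∀ k : ℕ, k ≤ m → pt k j ∈ (↑(rectangle m n) : Set (Site 2)) := by
    intro k hk
    simp only [Finset.mem_coe, mem_rectangle_iff, pt, Matrix.cons_val_zero, Matrix.cons_val_one,
      Matrix.cons_val_fin_one]
    omega
  intro k
  induction k with
  | zero => intro _; exact openConnIn_refl (hmem 0 (Nat.zero_le m))
  | succ k ih =>
    intro hk
    refine PlanarDuality.openConnIn_trans (ih (Nat.le_of_succ_le hk)) ?_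
    refine openConnIn_of_adj (hmem k (Nat.le_of_succ_le hk)) (hmem (k + 1) hk) ?_ ?_
    · exact_mod_cast h k (Nat.lt_of_succ_le hk)
    · intro heq
      have := congr_fun heq 0
      simp [pt] at this

/-- If all rungs `{(i,0),(i,1)}`, `0 ≤ i ≤ m`, are closed, an open lattice walk inside
`[0,m]×[0,n]` that starts in row `0` stays in row `0`. [folklore] -/
theorem walk_stays_in_row_zero {m n : ℕ} {ω : BondConfig (Site 2)}
    (hrung : ∀ i : ℕ, i ≤ m → s(pt i 0, pt i 1) ∉ ω) :
    ∀ {u v : Site 2} (P : (zdGraph 2).Walk u v),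
      (∀ z ∈ P.support, z ∈ (↑(rectangle m n) : Set (Site 2))) → (∀ e ∈ P.edges, e ∈ ω) →
        u 1 = 0 → v 1 = 0 := by
  intro u v P
  induction P with
  | nil => intro _ _ h; exact h
  | @cons u w v hadj P ih =>
    intro hS hE hu
    have hw : w ∈ (↑(rectangle m n) : Set (Site 2)) := hS w (by simp)
    have hu' : u ∈ (↑(rectangle m n) : Set (Site 2)) := hS u (by simp)
    simp only [Finset.mem_coe, mem_rectangle_iff] at hw hu'
    have he : s(u, w) ∈ ω := hE _ (by simp)
    have hw1 : w 1 = 0 := by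
      rcases (zdGraph_two_adj_iff u w).1 hadj with ⟨-, h1⟩ | ⟨-, h1⟩ | ⟨h1, h0⟩ | ⟨h1, -⟩
      · omega
      · omega
      · -- a rung `{(i,0),(i,1)}` would be open
        exfalso
        obtain ⟨i, hi⟩ : ∃ i : ℕ, (i : ℤ) = u 0 := ⟨(u 0).toNat, Int.toNat_of_nonneg hu'.1⟩
        have hueq : u = pt i 0 := by
          ext k; fin_cases k <;> simp [pt] <;> omega
        have hweq : w = pt i 1 := by
          ext k; fin_cases k <;> simp [pt] <;> omega
        refine hrung i (by omega) ?_
        rw [← hueq, ← hweq]; exact he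
      · omega
    exact ih (fun z hz => hS z (by simp [hz])) (fun e he' => hE e (by simp [he'])) hw1

/-- **The ladder configuration realises the two-cluster event** (for lattice configurations,
i.e. almost surely): rows `0` and `1` are two LR crossings, and the closed rungs seal row `0`. [folklore] -/
theorem ladder_subset_twoClusterEvent {m n : ℕ} (hn : 1 ≤ n) {ω : BondConfig (Site 2)}
    (hωE : ω ⊆ (zdGraph 2).edgeSet) (hω : ω ∈ ladderEvent m) : ω ∈ twoClusterEvent m n := by
  obtain ⟨hrows, hrungs⟩ := hω
  have h0 : ∀ i : ℕ, i < m → s(pt i 0, pt (i + 1) 0) ∈ ω := fun i hi =>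
    hrows (by simp only [ladderRows, bottomRowEdges, rowOneEdges, Finset.coe_union, Finset.coe_image,
      Finset.coe_range, Set.mem_union, Set.mem_image, Set.mem_Iio]; exact Or.inl ⟨i, hi, rfl⟩)
  have h1 : ∀ i : ℕ, i < m → s(pt i 1, pt (i + 1) 1) ∈ ω := fun i hi =>
    hrows (by simp only [ladderRows, bottomRowEdges, rowOneEdges, Finset.coe_union, Finset.coe_image,
      Finset.coe_range, Set.mem_union, Set.mem_image, Set.mem_Iio]; exact Or.inr ⟨i, hi, rfl⟩)
  have hrung : ∀ i : ℕ, i ≤ m → s(pt i 0, pt i 1) ∉ ω := fun i hi =>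
    hrungs _ (by simp only [rungEdges, Finset.mem_image, Finset.mem_range]; exact ⟨i, by omega, rfl⟩)
  refine ⟨pt 0 0, ?_, pt m 0, ?_, pt 0 1, ?_, pt m 1, ?_, openConnIn_row (Nat.zero_le n) h0 m le_rfl,
    openConnIn_row hn h1 m le_rfl, ?_⟩
  · simp [leftSide, pt, mem_rectangle_iff]
  · simp [rightSide, pt, mem_rectangle_iff]
  · simp [leftSide, pt, mem_rectangle_iff]; omega
  · simp [rightSide, pt, mem_rectangle_iff]; omega
  · intro hconn
    obtain ⟨P, hPs, hPe⟩ := exists_walk_of_mem_openConnIn hωE hconn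
    have := walk_stays_in_row_zero hrung P hPs hPe (by simp [pt])
    simp [pt] at this

/-- Rows and rungs are disjoint edge sets. [folklore] -/
theorem disjoint_ladderRows_rungEdges (m : ℕ) :
    Disjoint (↑(ladderRows m) : Set (Sym2 (Site 2))) ↑(rungEdges m) := by
  rw [Set.disjoint_left]
  intro e he hf
  simp only [ladderRows, bottomRowEdges, rowOneEdges, rungEdges, Finset.coe_union, Finset.coe_image,
    Finset.coe_range, Set.mem_union, Set.mem_image, Set.mem_Iio] at he hf
  obtain ⟨i, -, rfl⟩ := hf
  rcases he with ⟨i', -, h⟩ | ⟨i', -, h⟩ <;> rw [Sym2.eq_iff] at h <;>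
    rcases h with ⟨h₁, h₂⟩ | ⟨h₁, h₂⟩
  · have := congr_fun h₂ 1; simp [pt] at this
  · have := congr_fun h₁ 1; simp [pt] at this
  · have := congr_fun h₁ 1; simp [pt] at this
  · have := congr_fun h₂ 1; simp [pt] at this

/-- Ladder rows are lattice edges. [folklore] -/
theorem ladderRows_subset_edgeSet (m : ℕ) :
    (↑(ladderRows m) : Set (Sym2 (Site 2))) ⊆ (zdGraph 2).edgeSet := by
  intro e he
  simp only [ladderRows, bottomRowEdges, rowOneEdges, Finset.coe_union, Finset.coe_image,
    Finset.coe_range, Set.mem_union, Set.mem_image, Set.mem_Iio] at he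
  rcases he with ⟨i, -, rfl⟩ | ⟨i, -, rfl⟩ <;> rw [SimpleGraph.mem_edgeSet, zdGraph_adj_iff] <;>
    exact ⟨0, Or.inl (by exact_mod_cast pt_succ_eq i _)⟩

/-- The event "all ladder rows open" is determined by the ladder rows. [folklore] -/
theorem determinedBy_ladderRows (m : ℕ) :
    DeterminedBy {ω : BondConfig (Site 2) | (↑(ladderRows m) : Set (Sym2 (Site 2))) ⊆ ω} ↑(ladderRows m) := by
  rw [determinedBy_iff]
  intro ω ω' h
  simp only [Set.mem_setOf_eq]
  constructor
  · intro hsub e he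
    have : e ∈ ω' ∩ ↑(ladderRows m) := h ▸ ⟨hsub he, he⟩
    exact this.1
  · intro hsub e he
    have : e ∈ ω ∩ ↑(ladderRows m) := h.symm ▸ ⟨hsub he, he⟩
    exact this.1

/-- `P[ladder] ≥ 2^{-(3m+1)}`: `2m` prescribed open edges and `m+1` prescribed closed ones. [folklore] -/
theorem ladderEvent_ge (m : ℕ) :
    (1 / 2 : ℝ) ^ (3 * m + 1) ≤ (bondPercolation (zdGraph 2) half).real (ladderEvent m) := by
  have hA := determinedBy_ladderRows m
  have hB := determinedBy_forall_notMem (V := Site 2) (rungEdges m)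
  rw [ladderEvent, bondPercolation_real_inter_of_disjoint (zdGraph 2) half (disjoint_ladderRows_rungEdges m)
    hA hB (hA.measurableSet_of_finset) (measurableSet_forall_notMem _),
    bondPercolation_real_setOf_subset _ half _ (ladderRows_subset_edgeSet m)]
  have hcard1 : (ladderRows m).card ≤ 2 * m := by
    calc (ladderRows m).card ≤ (bottomRowEdges m).card + (rowOneEdges m).card := Finset.card_union_le _ _
      _ ≤ m + m := by
          gcongr
          · simpa [bottomRowEdges] using Finset.card_image_le (s := Finset.range m)
              (f := fun i : ℕ => s(pt i 0, pt (i + 1) 0))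
          · simpa [rowOneEdges] using Finset.card_image_le (s := Finset.range m)
              (f := fun i : ℕ => s(pt i 1, pt (i + 1) 1))
      _ = 2 * m := by ring
  have hcard2 : (rungEdges m).card ≤ m + 1 := by
    simpa [rungEdges] using Finset.card_image_le (s := Finset.range (m + 1))
      (f := fun i : ℕ => s(pt i 0, pt i 1))
  have hclosed : (1 / 2 : ℝ) ^ (m + 1) ≤ (bondPercolation (zdGraph 2) half).real {ω | ∀ e ∈ rungEdges m, e ∉ ω} := by
    calc (1 / 2 : ℝ) ^ (m + 1) ≤ (1 / 2 : ℝ) ^ (rungEdges m).card :=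
          pow_le_pow_of_le_one (by norm_num) (by norm_num) hcard2
      _ = (1 - (half : ℝ)) ^ (rungEdges m).card := by rw [coe_half]; norm_num
      _ ≤ _ := le_bondPercolation_real_forall_notMem (zdGraph 2) half (rungEdges m)
  have hopen : (1 / 2 : ℝ) ^ (2 * m) ≤ ((half : unitInterval) : ℝ) ^ (ladderRows m).card := by
    rw [coe_half]; exact pow_le_pow_of_le_one (by norm_num) (by norm_num) hcard1
  calc (1 / 2 : ℝ) ^ (3 * m + 1) = (1 / 2 : ℝ) ^ (2 * m) * (1 / 2 : ℝ) ^ (m + 1) := by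
        rw [← pow_add]; ring_nf
    _ ≤ ((half : unitInterval) : ℝ) ^ (ladderRows m).card *
          (bondPercolation (zdGraph 2) half).real {ω | ∀ e ∈ rungEdges m, e ∉ ω} :=
        mul_le_mul hopen hclosed (by positivity) (by rw [coe_half]; positivity)

/-- **`p₂(m,n) ≥ 2^{-(3m+1)}` for every `n ≥ 1`** (with equality at `n = 1`). [folklore] -/
theorem pTwo_ge {m n : ℕ} (hn : 1 ≤ n) : (1 / 2 : ℝ) ^ (3 * m + 1) ≤ pTwo m n := by
  refine (ladderEvent_ge m).trans ?_
  refine ENNReal.toReal_mono (measure_ne_top _ _) (measure_mono_ae ?_)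
  filter_upwards [ae_subset_edgeSet (zdGraph 2) half] with ω hω hL
  exact ladder_subset_twoClusterEvent hn hω hL

/-- `p₁(m,n) ≥ 2⁻ᵐ` (tree: the bottom row). [folklore] -/
theorem pOne_ge (m n : ℕ) : (1 / 2 : ℝ) ^ m ≤ pOne m n := by
  simpa using pow_le_crossingProb half m n

/-- Termwise bound on the first rate sequence: `-log p₁(m,n)/m ≤ log 2` for every `m`
(for `m = 0` both sides are the junk value `0 ≤ log 2`). [folklore] -/
theorem rateSeqOne_le (n m : ℕ) : rateSeqOne n m ≤ Real.log 2 := by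
  have hp : (0 : ℝ) < (1 / 2 : ℝ) ^ m := by positivity
  have hlog : -Real.log (pOne m n) ≤ m * Real.log 2 := by
    have := Real.log_le_log hp (pOne_ge m n)
    rw [Real.log_pow, one_div, Real.log_inv] at this
    linarith
  show -Real.log (pOne m n) / (m : ℝ) ≤ Real.log 2
  rcases Nat.eq_zero_or_pos m with rfl | hm
  · simp; positivity
  · rw [div_le_iff₀ (by exact_mod_cast hm)]
    linarith

/-- Termwise bound on the second rate sequence: `-log p₂(m,n)/m ≤ (3m+1) log 2 / m` (`n ≥ 1`). [folklore] -/
theorem rateSeqTwo_le {n : ℕ} (hn : 1 ≤ n) (m : ℕ) :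
    rateSeqTwo n m ≤ (3 * m + 1 : ℝ) * Real.log 2 / m := by
  have hp : (0 : ℝ) < (1 / 2 : ℝ) ^ (3 * m + 1) := by positivity
  have hlog : -Real.log (pTwo m n) ≤ (3 * m + 1 : ℝ) * Real.log 2 := by
    have := Real.log_le_log hp (pTwo_ge (m := m) hn)
    rw [Real.log_pow, one_div, Real.log_inv] at this
    push_cast at this
    linarith
  exact div_le_div_of_nonneg_right hlog (by positivity)

/-- **Every limit of `-log p₁(m,n)/m` is `≤ log 2`.** [folklore] -/
theorem rateOne_le {n : ℕ} {γ : ℝ} (h : Tendsto (rateSeqOne n) atTop (𝓝 γ)) : γ ≤ Real.log 2 :=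
  le_of_tendsto' h (rateSeqOne_le n)

/-- **Every limit of `-log p₂(m,n)/m` is `≤ 3 log 2`** (`n ≥ 1`). [folklore] -/
theorem rateTwo_le {n : ℕ} (hn : 1 ≤ n) {γ : ℝ} (h : Tendsto (rateSeqTwo n) atTop (𝓝 γ)) :
    γ ≤ 3 * Real.log 2 := by
  have hlim : Tendsto (fun m : ℕ ↦ (3 * m + 1 : ℝ) * Real.log 2 / m) atTop (𝓝 (3 * Real.log 2)) := by
    have h1 : Tendsto (fun m : ℕ ↦ 3 * Real.log 2 + Real.log 2 / (m : ℝ)) atTop (𝓝 (3 * Real.log 2 + 0)) :=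
      tendsto_const_nhds.add (tendsto_const_nhds.div_atTop tendsto_natCast_atTop_atTop)
    rw [add_zero] at h1
    refine h1.congr' ?_
    filter_upwards [eventually_ge_atTop 1] with m hm
    have : (m : ℝ) ≠ 0 := by exact_mod_cast (Nat.one_le_iff_ne_zero.mp hm)
    field_simp
  exact le_of_tendsto_of_tendsto h hlim (Eventually.of_forall (rateSeqTwo_le hn))

/-- Rates of `p₁` are antitone in the width: `p₁(m,n) ≤ p₁(m,n')` for `n ≤ n'`. [folklore] -/
theorem rateOne_antitone {n n' : ℕ} (hnn' : n ≤ n') {γ γ' : ℝ} (h : Tendsto (rateSeqOne n) atTop (𝓝 γ))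
    (h' : Tendsto (rateSeqOne n') atTop (𝓝 γ')) : γ' ≤ γ := by
  refine le_of_tendsto_of_tendsto h' h (Eventually.of_forall fun m ↦ ?_)
  have hp : (0 : ℝ) < pOne m n := lt_of_lt_of_le (by positivity) (pOne_ge m n)
  have := Real.log_le_log hp (crossingProb_mono_right half m hnn')
  exact div_le_div_of_nonneg_right (by simpa using this) (by positivity)

/-! ## §2 Refuted natural strengthenings: Kac from above / at every width -/

/-- `log 2 < π/3`. [folklore] -/
theorem log_two_lt_pi_div_three : Real.log 2 < Real.pi / 3 := by
  have := Real.log_two_lt_d9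
  have := Real.pi_gt_three
  linarith

/-- **STRENGTHENING 1 ("the one-cluster Kac value `π/3` bounds `n·γ₁(n)` from below at every width") is FALSE**: at width `n = 1`, `γ₁(1) ≤ log 2 < π/3` (numerically
`γ₁(1) = log(8/(3+√5)) = 0.42387…`). [folklore] -/
theorem not_kacLowerBoundEveryWidth_one :
    ¬ ∃ γ₁ : ℕ → ℝ, (∀ n : ℕ, 1 ≤ n → Tendsto (rateSeqOne n) atTop (𝓝 (γ₁ n))) ∧
        ∀ n : ℕ, 1 ≤ n → Real.pi / 3 ≤ n * γ₁ n := by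
  rintro ⟨γ₁, hγ, hlow⟩
  have h1 := rateOne_le (hγ 1 le_rfl)
  have h2 := hlow 1 le_rfl
  have := log_two_lt_pi_div_three
  push_cast at h2
  linarith

/-- At widths `n ≤ 3` the two-cluster rate is below the Kac value: `n·γ₂(n) ≤ 3n log 2 < 2π`. [folklore] -/
theorem kacTwo_fails_upto_three {n : ℕ} (hn1 : 1 ≤ n) (hn3 : n ≤ 3) {γ : ℝ}
    (h : Tendsto (rateSeqTwo n) atTop (𝓝 γ)) : (n : ℝ) * γ < 2 * Real.pi := by
  have hγ := rateTwo_le hn1 h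
  have hlog := Real.log_two_lt_d9
  have hpi := Real.pi_gt_d2
  have hn : (n : ℝ) ≤ 3 := by exact_mod_cast hn3
  have hn0 : (0 : ℝ) ≤ n := by positivity
  calc (n : ℝ) * γ ≤ n * (3 * Real.log 2) := mul_le_mul_of_nonneg_left hγ hn0
    _ ≤ 3 * (3 * Real.log 2) := by
        apply mul_le_mul_of_nonneg_right hn
        have := Real.log_pos one_lt_two
        positivity
    _ < 2 * Real.pi := by linarith

/-- **STRENGTHENING 2 ("the two-cluster Kac value `2π` bounds `n·γ₂(n)` from below at every width") is FALSE** (already at width `1`; in fact at every width `≤ 3`). [folklore] -/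
theorem not_kacLowerBoundEveryWidth_two :
    ¬ ∃ γ₂ : ℕ → ℝ, (∀ n : ℕ, 1 ≤ n → Tendsto (rateSeqTwo n) atTop (𝓝 (γ₂ n))) ∧
        ∀ n : ℕ, 1 ≤ n → 2 * Real.pi ≤ n * γ₂ n := by
  rintro ⟨γ₂, hγ, hlow⟩
  have h1 := kacTwo_fails_upto_three le_rfl (by norm_num) (hγ 1 le_rfl)
  have h2 := hlow 1 le_rfl
  linarith

/-! ## §3 The rigorous window is two-sided but non-sharp -/

/-- **RSW upper bound on the one-cluster rate at odd widths**: `γ₁(2j+1) ≤ 8 log 2/(j+1)`, from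
the tree's Bollobás–Riordan constant `h(3n,2n) ≥ 2⁻⁷` and gluing (`crossingProb_long_le`). Hence
`limsup n·γ₁(n) ≤ 16 log 2 ≈ 11.09` (even widths by `rateOne_antitone`) — the claimed `π/3 ≈ 1.047`
is far inside the rigorous window; no RSW-type argument can decide it. [folklore] -/
theorem rateOne_odd_width_le {j : ℕ} {γ : ℝ} (h : Tendsto (rateSeqOne (2 * j + 1)) atTop (𝓝 γ)) :
    γ ≤ 8 * Real.log 2 / (j + 1) := by
  -- along the subsequence m_t = 3j+2+t(j+1) every term is ≤ 8 log 2/(j+1)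
  have hsub : Tendsto (fun t : ℕ ↦ 3 * j + 2 + t * (j + 1)) atTop atTop := by
    refine tendsto_atTop_mono (fun t ↦ ?_) tendsto_id
    simp only [id]; nlinarith
  refine le_of_tendsto' (h.comp hsub) fun t ↦ ?_
  have hlow := crossingProb_long_le BollobasRiordan2006_cor5_holds crossingProb_glue_holds
    crossingProb_half_succ_self_holds j t
  have hp : (0 : ℝ) < (2 : ℝ)⁻¹ ^ (7 + 8 * t) := by positivity
  have hlog : -Real.log (pOne (3 * j + 2 + t * (j + 1)) (2 * j + 1)) ≤ (7 + 8 * t : ℝ) * Real.log 2 := by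
    have := Real.log_le_log hp hlow
    rw [Real.log_pow, Real.log_inv] at this
    push_cast at this
    linarith
  have hm : (0 : ℝ) < (3 * j + 2 + t * (j + 1) : ℕ) := by positivity
  show -Real.log (pOne (3 * j + 2 + t * (j + 1)) (2 * j + 1)) / ((3 * j + 2 + t * (j + 1) : ℕ) : ℝ) ≤ _
  rw [div_le_div_iff₀ hm (by positivity)]
  have hl : 0 < Real.log 2 := Real.log_pos one_lt_two
  have key : (8 : ℝ) * ((3 * j + 2 + t * (j + 1) : ℕ) : ℝ) - (7 + 8 * t) * (j + 1) = 17 * j + 9 := by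
    push_cast; ring
  have hj : (0 : ℝ) ≤ j := by positivity
  calc -Real.log (pOne (3 * j + 2 + t * (j + 1)) (2 * j + 1)) * ((j : ℝ) + 1)
        ≤ (7 + 8 * t : ℝ) * Real.log 2 * ((j : ℝ) + 1) := mul_le_mul_of_nonneg_right hlog (by positivity)
    _ = ((7 + 8 * t : ℝ) * ((j : ℝ) + 1)) * Real.log 2 := by ring
    _ ≤ ((8 : ℝ) * ((3 * j + 2 + t * (j + 1) : ℕ) : ℝ)) * Real.log 2 :=
        mul_le_mul_of_nonneg_right (by linarith) hl.le
    _ = 8 * Real.log 2 * ((3 * j + 2 + t * (j + 1) : ℕ) : ℝ) := by ring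

/-- Readback: the crux is literally the statement about `rateSeqOne`, `rateSeqTwo` (definitional). [folklore] -/
theorem stripClusterRates_iff :
    StripClusterRates ↔
      ∃ γ₁ γ₂ : ℕ → ℝ,
        (∀ n : ℕ, 1 ≤ n → Tendsto (rateSeqOne n) atTop (𝓝 (γ₁ n))) ∧
        (∀ n : ℕ, 1 ≤ n → Tendsto (rateSeqTwo n) atTop (𝓝 (γ₂ n))) ∧
        Tendsto (fun n : ℕ ↦ (n : ℝ) * γ₁ n) atTop (𝓝 (Real.pi / 3)) ∧
        Tendsto (fun n : ℕ ↦ (n : ℝ) * γ₂ n) atTop (𝓝 (2 * Real.pi)) :=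
  Iff.rfl

/-- Under the crux, the finite-width rates it provides obey the bounds of this file: in
particular `1·γ₁(1) ≤ log 2 < π/3` and `n·γ₂(n) < 2π` for `n ≤ 3` — the limits `π/3`, `2π` are
approached, not attained, and not from above at small widths. [folklore] -/
theorem stripClusterRates_smallWidth_below_kac (h : StripClusterRates) :
    ∃ γ₁ γ₂ : ℕ → ℝ,
      (∀ n : ℕ, 1 ≤ n → Tendsto (rateSeqOne n) atTop (𝓝 (γ₁ n))) ∧
      (∀ n : ℕ, 1 ≤ n → Tendsto (rateSeqTwo n) atTop (𝓝 (γ₂ n))) ∧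
      (1 : ℝ) * γ₁ 1 < Real.pi / 3 ∧ (∀ n : ℕ, 1 ≤ n → n ≤ 3 → (n : ℝ) * γ₂ n < 2 * Real.pi) := by
  obtain ⟨γ₁, γ₂, h1, h2, -, -⟩ := h
  refine ⟨γ₁, γ₂, h1, h2, ?_, fun n hn hn3 ↦ kacTwo_fails_upto_three hn hn3 (h2 n hn)⟩
  have := rateOne_le (h1 1 le_rfl)
  have := log_two_lt_pi_div_three
  linarith

end Summit.CriticalPhenomena.CardyFormulaZ2.Theorems.StripClusterRates.Negative
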